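import Summits.QuantumFields.BalabanUV.Beta.GAN24.SrecWilsonSector

/-!
# `BalabanUV.Beta.GAN24.SrecAtRateOfSectors` — binder row G-an2-4 / (CONV-C), CT-ROUTE, CT-4e part 4: THE SOCKET «(hSall) FOR THE RECURSIVE COMB FAMILY `SrecAt`
# FROM ITS TWO SECTORS' RATE LETTERS» — hSdev of the Wilson lineage `wilsonSecAt` (the owner's `WilsonSectorRate`, CT-4e) and hBdev of the border∕Λ-born remainder
# `bornSecAt` (the crux team's sockets: leaf-06 g41's `BornLambdaDriftSup`, leaf-04 g57's `BornBorderDrift(Three)` + junction `exists_hBdev_of_sectors`), by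
# leaf-03 g52's `SrecAt_eq_wilsonSecAt_add_bornSecAt` and the additivity of the change of units (row owner; generic `d`; the rate twin of `SrecAtRowOfSectors`).

NOT IN PRINT; OUR BOOKKEEPING ([folklore]: `SrecWilsonSector.SrecAt_eq_wilsonSecAt_add_bornSecAt` + `StencilSlotOfShapes.unitS_add` + lit `locStencil_add` at the
common rate `δ = min`, common ratio `θ = max` (the W-slot twin is an2's `WSlotCauchyOfShapes`); no estimate, no cited fact, no `def`, no `def … : Prop`, 0 sorry).  HONEST FRAMING (cell contract, verbatim): «discharging
`BetaPertH` makes Bałaban's UV stability UNCONDITIONAL — a real constructive-QFT result; it is NOT the continuum limit and NOT the Clay problem.»  HONEST DEPENDENCY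
(verbatim): «continuum YM on T⁴ ⇐ BetaPertH ∧ nine spine estimates (0/9 proved); BetaPertH ⇐ (D1) ∧ (D4) ∧ CAP+tail; G-an2-4 gates asym, D1 and NE2/3/4.»  Discharges
NOTHING by itself (both sector letters are HYPOTHESES here); when both land, (hSall) for the comb family `SrecAt` — LITERALLY the binder `hSall` of an2's
`HessKerCoDressedBmWallRec.d1Drift_JsRecBmAtOf_iff_of_slots` — is two `exact`s; the sym family `JsB12Sym` is CT-5.  NEVER «G-an2-4 closed» as (CONV-C); NOT D1,
NOT `BetaPertH`, NOT continuum, NOT Clay.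
Unit `b2b-balaban-gan24-p1` (row owner G-an2-4, gen 22), 2026-08-21.
-/

noncomputable section

open Literature.MathematicalPhysics.QuantumFieldTheory.Balaban1983to89.Beta
open OneStepResolventKernel (LocStencil)
open StepJetData (locStencil_add)
open AffineAveraging (box toSite)
open Summit.QuantumFields.BalabanUV.Beta.HessKerDressedUnits (unitS)
open Summit.QuantumFields.BalabanUV.Beta.GAN24.CombesThomas (sfStep smStep)
open Summit.QuantumFields.BalabanUV.Beta.WardLocusRecursive (SrecAt)
open Summit.QuantumFields.BalabanUV.Beta.GAN24.SrecWilsonSector (wilsonSecAt bornSecAt SrecAt_eq_wilsonSecAt_add_bornSecAt)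
open Summit.QuantumFields.BalabanUV.Beta.GAN24.StencilSlotOfShapes (unitS_add locStencil_mono')

namespace Summit.QuantumFields.BalabanUV.Beta.GAN24.SrecAtRateOfSectors

variable {d Lc : ℕ} [NeZero Lc]

/-- NOT IN PRINT; OUR BOOKKEEPING.  **(hSall) FOR THE COMB RECURSIVE FAMILY FROM ITS TWO SECTORS' RATE LETTERS** (generic `d`, any coefficients): all-scales
Cauchy letters for the unit tables of the Wilson lineage `wilsonSecAt` (hSdev: `cW·θW^k` at rate `δW`, every in-block root) and of the remainder `bornSecAt`
(hBdev: `cB·θB^k` at `δB`) give the same for `SrecAt` — constant `cW + cB`, ratio `max θW θB`, rate `min δW δB`. -/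
theorem exists_hSall_SrecAt_of_sectors (cE cVH cΛ : ℝ)
    (hW : ∃ cW θW δW : ℝ, 0 ≤ cW ∧ 0 ≤ θW ∧ θW < 1 ∧ 0 < δW ∧ ∀ (rr : Fin (d + 1) → ℕ), rr ∈ box (d + 1) Lc → ∀ k j : ℕ,
      LocStencil (unitS (sfStep Lc (k + j)) (smStep d Lc (k + j)) (wilsonSecAt Lc (toSite rr) cE (k + j))
        - unitS (sfStep Lc k) (smStep d Lc k) (wilsonSecAt Lc (toSite rr) cE k)) (cW * θW ^ k) δW)
    (hB : ∃ cB θB δB : ℝ, 0 ≤ cB ∧ 0 ≤ θB ∧ θB < 1 ∧ 0 < δB ∧ ∀ (rr : Fin (d + 1) → ℕ), rr ∈ box (d + 1) Lc → ∀ k j : ℕ,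
      LocStencil (unitS (sfStep Lc (k + j)) (smStep d Lc (k + j)) (bornSecAt Lc (toSite rr) cE cVH cΛ (k + j))
        - unitS (sfStep Lc k) (smStep d Lc k) (bornSecAt Lc (toSite rr) cE cVH cΛ k)) (cB * θB ^ k) δB) :
    ∃ cS θS δS : ℝ, 0 ≤ cS ∧ 0 ≤ θS ∧ θS < 1 ∧ 0 < δS ∧ ∀ (rr : Fin (d + 1) → ℕ), rr ∈ box (d + 1) Lc → ∀ k j : ℕ,
      LocStencil (unitS (sfStep Lc (k + j)) (smStep d Lc (k + j)) (SrecAt d Lc (toSite rr) cE cVH cΛ (k + j))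
        - unitS (sfStep Lc k) (smStep d Lc k) (SrecAt d Lc (toSite rr) cE cVH cΛ k)) (cS * θS ^ k) δS := by
  obtain ⟨cW, θW, δW, hcW, hθW0, hθW1, hδW, hW⟩ := hW
  obtain ⟨cB, θB, δB, hcB, hθB0, hθB1, hδB, hB⟩ := hB
  set θ : ℝ := max θW θB with hθ
  have hθ0 : 0 ≤ θ := le_max_of_le_left hθW0
  have hθ1 : θ < 1 := max_lt hθW1 hθB1
  refine ⟨cW + cB, θ, min δW δB, by positivity, hθ0, hθ1, lt_min hδW hδB, fun rr hrr k j => ?_⟩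
  have e : ∀ n : ℕ, unitS (sfStep Lc n) (smStep d Lc n) (SrecAt d Lc (toSite rr) cE cVH cΛ n) = fun κ u =>
      unitS (sfStep Lc n) (smStep d Lc n) (wilsonSecAt Lc (toSite rr) cE n) κ u
        + unitS (sfStep Lc n) (smStep d Lc n) (bornSecAt Lc (toSite rr) cE cVH cΛ n) κ u := by
    intro n
    rw [SrecAt_eq_wilsonSecAt_add_bornSecAt (toSite rr) cE cVH cΛ n]
    exact unitS_add _ _ _ _
  have e2 : unitS (sfStep Lc (k + j)) (smStep d Lc (k + j)) (SrecAt d Lc (toSite rr) cE cVH cΛ (k + j))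
        - unitS (sfStep Lc k) (smStep d Lc k) (SrecAt d Lc (toSite rr) cE cVH cΛ k)
      = fun κ u => (unitS (sfStep Lc (k + j)) (smStep d Lc (k + j)) (wilsonSecAt Lc (toSite rr) cE (k + j))
          - unitS (sfStep Lc k) (smStep d Lc k) (wilsonSecAt Lc (toSite rr) cE k)) κ u
        + (unitS (sfStep Lc (k + j)) (smStep d Lc (k + j)) (bornSecAt Lc (toSite rr) cE cVH cΛ (k + j))
          - unitS (sfStep Lc k) (smStep d Lc k) (bornSecAt Lc (toSite rr) cE cVH cΛ k)) κ u := by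
    rw [e (k + j), e k]
    funext κ u x y a b
    simp only [Pi.sub_apply, Pi.add_apply]
    ring
  rw [e2, add_mul]
  refine locStencil_add ?_ ?_
  · exact locStencil_mono' (hW rr hrr k j) (mul_le_mul_of_nonneg_left (pow_le_pow_left₀ hθW0 (le_max_left _ _) k) hcW) (min_le_left _ _)
  · exact locStencil_mono' (hB rr hrr k j) (mul_le_mul_of_nonneg_left (pow_le_pow_left₀ hθB0 (le_max_right _ _) k) hcB) (min_le_right _ _)

end Summit.QuantumFields.BalabanUV.Beta.GAN24.SrecAtRateOfSectors

end
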